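import Mathlib
import Summits.ValiantsHypothesis.ValiantsHypothesis.Theses.ProofCarryingSymmetry

/-!
# Route ProofCarryingSymmetry — crux `RestorationQP`, line `registered`: the coset-covering engine for graded stability

Support file for the crux item `stmt-ValiantsHypothesis-10343` (lead c4, cycle 4).  The bet of the line
(S2⁗ ≡ L, item stmt-10358) is open from distributivity budget `t = 1` on
(`proofCarryingSymmetry_at_distBudgetZero` settles `t = 0`).  This file isolates and PROVES the
group-theoretic half of the proposed mechanism for the graded statements S3^(t) ("≤ t instances of
distributivity per invariance proof ⇒ a symmetric circuit at polynomial cost") — B. H. Neumann's lemma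
on coverings of a group by cosets (Mathlib `Subgroup.exists_index_le_card_of_leftCoset_cover`) — in the
abstract form in which the rewriting half will feed it:

* a group `G` (intended: `S_n`) acts on "normal forms" `N` (intended: constant-normal AC-classes of
  Hrubeš–Tzameret formulas, `ACStability.cnormClass`) and on "instances" `I` (intended: ground
  distributivity instances `P(Q+R) = PQ + PR`);
* `Φ e T` is an EQUIVARIANT saturation (intended: exhaustively rewrite every `e`-redex of `T`,
  `Φ (g • e) (g • T) = g • Φ e T`; the rewriting half must show that inter-derivability of `T` and `T'`
  in the AC+units+constants congruence extended by the one ground equation `e` implies `Φ e T = Φ e T'`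
  — a Church–Rosser statement — and that the relevant instances form a set `R` of polynomial size);
* HYPOTHESIS: for every `g` some instance `e ∈ R` with `g⁻¹ • e ∈ R` has `Φ e (g • T) = Φ e T`
  (what "one instance per permutation" delivers);
* CONCLUSION (`exists_index_le_of_saturation_cover`): some saturation `Φ e T`, `e ∈ R`, has a
  stabilizer of index `≤ |R|²` in `G`.

With the cycle-1 engine (the AC-canonical circuit of a normal form is symmetric under its stabilizer,
`ACStability.isSymmetric_acCircuit`) and symmetrisation over the `≤ |R|²` cosets, this is exactly the
shape of the bet's conclusion: a symmetric circuit of size polynomial in `|C|` times `|R|^{2}` — and,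
iterated over `t` instances, `|R|^{O(t)}`, i.e. the polynomial-in-`(|C| + t + n)` form the route posits
for L.  So the bet's open content at budget `t` is reduced to a pure rewriting statement (Church–Rosser
for `t` ground distributivity instances modulo AC+units+constants, with polynomially many relevant
instances).  Proof of the lemma: the `g` with `g⁻¹ • e = e'` and `Φ e (g • T) = Φ e T` satisfy
`g • Φ e' T = Φ e T`, hence lie in ONE left coset of `Stab(Φ e' T)`; these `≤ |R|²` cosets cover `G`;
Neumann.  Everything proved; no named facts.
-/

-- single-problem summit: `Summit.ValiantsHypothesis.ValiantsHypothesis.…` is the namespace by design (D-0017)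
set_option linter.dupNamespace false

namespace Summit.ValiantsHypothesis.ValiantsHypothesis.Theorems

namespace CoverStability

open scoped Pointwise

variable {G : Type*} [Group G] {N I : Type*} [MulAction G N] [MulAction G I]

/-- **One coset per pair of instances.** For an equivariant saturation, every `g` with
`g⁻¹ • e = e'` and `Φ e (g • T) = Φ e T` lies in the left coset `g₀ • Stab(Φ e' T)` of any other such
`g₀`. [folklore] -/
theorem mem_coset_of_transport (Φ : I → N → N)
    (hΦ : ∀ (g : G) (e : I) (T : N), Φ (g • e) (g • T) = g • Φ e T) (T : N) {e e' : I}
    {g₀ : G} (h₀e : g₀⁻¹ • e = e') (h₀Φ : Φ e (g₀ • T) = Φ e T)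
    {g : G} (hge : g⁻¹ • e = e') (hgΦ : Φ e (g • T) = Φ e T) :
    g ∈ g₀ • (MulAction.stabilizer G (Φ e' T) : Set G) := by
  have he : g • e' = e := by rw [← hge, smul_inv_smul]
  have he₀ : g₀ • e' = e := by rw [← h₀e, smul_inv_smul]
  have h1 : g • Φ e' T = Φ e T := by rw [← hΦ, he, hgΦ]
  have h2 : g₀ • Φ e' T = Φ e T := by rw [← hΦ, he₀, h₀Φ]
  refine ⟨g₀⁻¹ * g, ?_, by simp⟩
  show g₀⁻¹ * g ∈ MulAction.stabilizer G (Φ e' T)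
  rw [MulAction.mem_stabilizer_iff, mul_smul, h1, ← h2, inv_smul_smul]

end CoverStability

open scoped Pointwise in
/-- **The coset-covering engine for graded stability** (B. H. Neumann's lemma, abstract form).  Let a
group `G` act on normal forms `N` and on instances `I`, and let `Φ` be an equivariant saturation
(`Φ (g • e) (g • T) = g • Φ e T`).  If for every `g ∈ G` some instance `e` of a finite set `R`, with
`g⁻¹ • e ∈ R` as well, has `Φ e (g • T) = Φ e T`, then for some `e ∈ R` the stabilizer of the
saturation `Φ e T` has finite index at most `|R|·|R|` in `G`.  (The `g` with `g⁻¹ • e = e'` and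
`Φ e (g • T) = Φ e T` form one left coset of `Stab(Φ e' T)`; these `≤ |R|²` cosets cover `G`; apply
`Subgroup.exists_index_le_card_of_leftCoset_cover`.) [folklore] -/
theorem exists_index_le_of_saturation_cover : ∀ {G : Type} [Group G] {N I : Type} [MulAction G N] [MulAction G I] (Φ : I → N → N), (∀ (g : G) (e : I) (T : N), Φ (g • e) (g • T) = g • Φ e T) → ∀ (T : N) (R : Finset I), (∀ g : G, ∃ e ∈ R, g⁻¹ • e ∈ R ∧ Φ e (g • T) = Φ e T) → ∃ e ∈ R, (MulAction.stabilizer G (Φ e T)).FiniteIndex ∧ (MulAction.stabilizer G (Φ e T)).index ≤ R.card * R.card := by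
  intro G _ N I _ _ Φ hΦ T R h
  classical
  -- the transporter sets, one per pair of instances, and one representative of each inhabited one
  let S : I × I → Set G := fun p => {g : G | g⁻¹ • p.1 = p.2 ∧ Φ p.1 (g • T) = Φ p.1 T}
  let rep : I × I → G := fun p => if hp : (S p).Nonempty then hp.some else 1
  have hcov : ⋃ p ∈ R ×ˢ R, rep p • (MulAction.stabilizer G (Φ p.2 T) : Set G) = Set.univ := by
    refine Set.eq_univ_of_forall fun g => ?_
    obtain ⟨e, he, he', hΦe⟩ := h g
    have hgS : g ∈ S (e, g⁻¹ • e) := ⟨rfl, hΦe⟩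
    have hne : (S (e, g⁻¹ • e)).Nonempty := ⟨g, hgS⟩
    have hrep : rep (e, g⁻¹ • e) ∈ S (e, g⁻¹ • e) := by
      simp only [rep, dif_pos hne]
      exact hne.some_mem
    obtain ⟨h₀e, h₀Φ⟩ := hrep
    exact Set.mem_iUnion₂.2 ⟨(e, g⁻¹ • e), Finset.mk_mem_product he he',
      CoverStability.mem_coset_of_transport Φ hΦ T h₀e h₀Φ rfl hΦe⟩
  obtain ⟨p, hp, hfin, hidx⟩ := Subgroup.exists_index_le_card_of_leftCoset_cover hcov
  refine ⟨p.2, (Finset.mem_product.1 hp).2, hfin, hidx.trans ?_⟩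
  rw [Finset.card_product]

end Summit.ValiantsHypothesis.ValiantsHypothesis.Theorems
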